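import Mathlib
import HarnessLib
import Summits.HubbardSuperconductivity.HubbardSuperconductivity.Theorems.KLProgrammeKLRegimeEnginePairLadderMemberCompose
import Summits.HubbardSuperconductivity.HubbardSuperconductivity.Theorems.KLProgrammeKLRegimeEngineV8PairTransferExport

/-!
# Route `KLProgramme` — crux K3, ENGINE child gen 8 (stmt-HubbardSuperconductivity-20437 `KLRegimeEngineV17F2`), stub (c) `stub_engine_step_values`,
# skeleton v2 class #5 (`…EngineV8PairTransferExport`, p544581): the (E2-F2) step FROM A HISTORY MEMBER, BY NAME — `pairLadderStepAtV17F2_of_pairTransferAtCov`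

Cell gate-hubbard-kl, seat hubbard-kl-k3c1-p1 (g9), technique «composed-map remainder propagation».  KLTC-INDEX-v6 §B step 3 keyed on the landed class-#5
text: the history member `PairTransferAtCov … (n−1) D` (p1 g11; any admissible smearing covariance `D` — the (c) closer takes the complementary member
`D = D^{K_{n−1}}_{n−1} − D^{K_{n−1}}_n`, whose step-`n` tower ends at the PLAIN array) supplies per pair class the transfer weight `t` (mass `≤ G.bhi/4`,
near-NONPOSITIVITY `Σ(|t|+t) ≤ klEdge G (n−1) |Qm|`), a right inverse `Mt` of `1 − diag t·klPairArrayF (n−1) Qm` and the defect `≤ transferBarAt … (n−1)` on the bare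
ball; the caller supplies the member's TOWER along slice `n` against an array `X` that agrees with the member amplitude on the bare ball (and vanishes off it):
`(1 + diag w₁·X)N = 1`, `‖klPairArrayF n − X·N‖ ≤ E_a` on the ball (frame shift folded into `E_a`), the tower weight's mass `Σ|w₁| ≤ (3/4)G.bhi` and same-slice
near-positivity `Σ(|w₁| − w₁) ≤ klEdge G n |Qm|`, the intermediate majorant `E₁ ≥ E_a + FT_{|w₁|}(transferBarAt (n−1))`, smallness, and `E₁ ≤` the (E2-F2) budget line.
THEN `PairLadderStepAtV17F2 … n` with the composite weight `w₁ − t`: its mass line is `Σ|w₁| + Σ|t| ≤ bhi`, its sign line `Σ(|w₁|−w₁) + Σ(|t|+t) ≤ klEdge n + klEdge (n−1)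
≤ 2·klEdge n` (`sum_negPart_add_le`, `klEdge_mono_scale`) — p1's E2-FAMILY-NOTE §3: only the SIGN of the inherited weight is used.

Also `klEdge_mono_scale` (the edge allowance grows with the scale index) and `isPairClassAt` nesting is `isPairClassAt_mono` (p1b lineage).  Exact algebra over
`pairLadderStepAtV17F2_of_member_fwd` (p544345); nothing about the model's sizes is asserted.  0 kit.
-/

noncomputable section

namespace Summit.HubbardSuperconductivity.HubbardSuperconductivity.Theorems.KLRegimeSplit

set_option linter.dupNamespace false -- summit = problem name (single-conjunct summit), D-0017

open Finset Matrix Literature.MathematicalPhysics.QuantumLattice Literature.Probability.LatticeModels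
open Summit.HubbardSuperconductivity.HubbardSuperconductivity.Theorems.KLProgrammeLegKernels

/-- **The edge allowance grows with the scale index**: `klEdge G j ρ ≤ klEdge G n ρ` for `j ≤ n` (`0 ≤ G.bhi`, `0 ≤ ρ`; `Λ_n ≤ Λ_j`). -/
theorem klEdge_mono_scale {G : GeoConsts} (hG : 0 ≤ G.bhi) {ρ : ℝ} (hρ : 0 ≤ ρ) {j n : ℕ} (hjn : j ≤ n) : klEdge G j ρ ≤ klEdge G n ρ := by
  rw [klEdge_eq_pow, klEdge_eq_pow]
  refine mul_le_mul_of_nonneg_left (min_le_min_left _ ?_) hG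
  exact mul_le_mul_of_nonneg_left (pow_le_pow_right₀ (by norm_num) (by omega)) (by positivity)

section Model

variable (L M : ℕ) [NeZero L] [NeZero M]

/-- **(E2-F2) `PairLadderStepAtV17F2 … n` (`1 ≤ n`) from the class-#5 HISTORY MEMBER `PairTransferAtCov … (n−1) D` and its tower along slice `n`, BY NAME.**
See the module docstring for the caller's per-class data. -/
theorem pairLadderStepAtV17F2_of_pairTransferAtCov {G : GeoConsts} {P : SplitConsts} {Q : EngConsts} {r β U μ : ℝ} {n : ℕ} {m : ℝ}
    {D : Matrix (HubbardFieldIdx L M) (HubbardFieldIdx L M) ℂ} (hn : 1 ≤ n) (hG : 0 ≤ G.bhi) (hm : 0 ≤ m)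
    (hC₀ : ∀ Qm s t, ‖klPairArrayF L M β U μ (n - 1) Qm s t‖ ≤ m)
    (hhist : PairTransferAtCov L M G P r β U μ (n - 1) D)
    (hR'0 : ∀ Qm k k', 0 ≤ transferBarAt L G P r β U (n - 1) Qm k k')
    (hsm₀ : m * (G.bhi / 4) ≤ 1 / 3)
    (htower : ∀ Qm : TorusSite 2 L, IsPairClassAt L Qm n →
      ∃ (X N : Matrix (TorusSite 2 L) (TorusSite 2 L) ℂ) (w₁ : TorusSite 2 L → ℝ) (Ea E₁ : TorusSite 2 L → TorusSite 2 L → ℝ) (r' e₁ : ℝ),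
        0 ≤ r' ∧ 0 ≤ e₁ ∧
        (∀ x y, ¬(x ∈ klBall L μ 0 ∧ y ∈ klBall L μ 0) → X x y = 0) ∧
        (∀ k ∈ klBall L μ 0, ∀ k' ∈ klBall L μ 0,
          X k k' = klCovSmearedPairAmplitude L M β U μ (klFlowFrameU L M β U μ (n - 1)) (n - 1) D Qm k k') ∧
        (∀ x y, 0 ≤ Ea x y) ∧
        (1 + diagonal (fun p => (w₁ p : ℂ)) * X) * N = 1 ∧
        (∀ k ∈ klBall L μ 0, ∀ k' ∈ klBall L μ 0, ‖klPairArrayF L M β U μ n Qm k k' - (X * N) k k'‖ ≤ Ea k k') ∧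
        (∀ x y, transferBarAt L G P r β U (n - 1) Qm x y ≤ r') ∧
        (∀ x y, Ea x y + (transferBarAt L G P r β U (n - 1) Qm x y +
            3 / 2 * (3 / 2 * m) * ∑ t, transferBarAt L G P r β U (n - 1) Qm x t * |w₁ t| +
            3 / 2 * (3 / 2 * m + r') * ∑ a, |w₁ a| * transferBarAt L G P r β U (n - 1) Qm a y +
            9 / 4 * (3 / 2 * m + r') * (3 / 2 * m) * ∑ a, ∑ t, |w₁ a| * transferBarAt L G P r β U (n - 1) Qm a t * |w₁ t|) ≤ E₁ x y) ∧
        (∀ x y, E₁ x y ≤ e₁) ∧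
        (3 / 2 * m + r') * ∑ a, |w₁ a| ≤ 1 / 3 ∧
        (∑ p, |w₁ p| ≤ 3 / 4 * G.bhi) ∧
        (∑ p, (|w₁ p| - w₁ p) ≤ klEdge G n (klTorusNorm L Qm)) ∧
        (∀ k ∈ klBall L μ 0, ∀ k' ∈ klBall L μ 0,
          E₁ k k' ≤
            drivePBar G P U (n - 1) + eremBar G P Q U β L (n - 1) + thermalBar G P U β n +
              legDressBarQ2 G P Q U n (legSliceCountT L β μ (klFlowFrameU L M β U μ n) n ![k', Qm - k', Qm - k, k]) +
              (P.Klam * U) ^ 2 * (G.phGain n (klTorusNorm L (k - k')) + G.phGain n (klTorusNorm L (k + k' - Qm))) +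
              frameShiftBar P Q U n)) :
    PairLadderStepAtV17F2 L M G P Q β U μ n := by
  refine pairLadderStepAtV17F2_of_member_fwd L M hn hm hC₀ fun Qm hQm => ?_
  -- the history member at resolution `n − 1` (pair classes are nested)
  have hQm' : IsPairClassAt L Qm (n - 1) := isPairClassAt_mono L hQm (Nat.sub_le n 1)
  obtain ⟨t, htmass, htneg, Mt, hMt, hbd⟩ := hhist Qm hQm'
  obtain ⟨X, N, w₁, Ea, E₁, r', e₁, hr', he₁, hX0, hXeq, hEa0, hN, hEa, hR'e, hE₁, hE₁e, hsm₁, hw₁mass, hw₁neg, hbud⟩ := htower Qm hQm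
  -- the history defect against the caller's array `X`
  have hR' : ∀ k ∈ klBall L μ 0, ∀ k' ∈ klBall L μ 0,
      ‖X k k' - (klPairArrayF L M β U μ (n - 1) Qm * Mt) k k'‖ ≤ transferBarAt L G P r β U (n - 1) Qm k k' := by
    intro k hk k' hk'
    rw [hXeq k hk k' hk']
    exact hbd k hk k' hk'
  -- smallness of the history weight
  have hsm₀' : m * ∑ a, |t a| ≤ 1 / 3 := (mul_le_mul_of_nonneg_left htmass hm).trans hsm₀
  -- the composite weight's two mass lines
  have hmass : ∑ p, |w₁ p - t p| ≤ G.bhi := by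
    calc ∑ p, |w₁ p - t p| ≤ ∑ p, (|w₁ p| + |t p|) := sum_le_sum fun p _ => abs_sub _ _
      _ = ∑ p, |w₁ p| + ∑ p, |t p| := sum_add_distrib
      _ ≤ 3 / 4 * G.bhi + G.bhi / 4 := add_le_add hw₁mass htmass
      _ = G.bhi := by ring
  have hρ0 : 0 ≤ klTorusNorm L Qm := by unfold klTorusNorm; exact torusSupNorm_nonneg _
  have hneg : ∑ p, (|w₁ p - t p| - (w₁ p - t p)) ≤ 2 * klEdge G n (klTorusNorm L Qm) := by
    have h1 := sum_negPart_add_le (Finset.univ : Finset (TorusSite 2 L)) w₁ (fun p => -t p)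
    simp only [abs_neg, sub_neg_eq_add, ← sub_eq_add_neg] at h1
    have h2 : klEdge G (n - 1) (klTorusNorm L Qm) ≤ klEdge G n (klTorusNorm L Qm) := klEdge_mono_scale hG hρ0 (Nat.sub_le n 1)
    linarith
  exact ⟨X, Mt, N, t, w₁, fun x y => transferBarAt L G P r β U (n - 1) Qm x y, Ea, E₁, r', e₁, hr', he₁, hX0, fun x y => hR'0 Qm x y, hEa0,
    hMt, hR', hR'e, hN, hEa, hE₁, hE₁e, hsm₀', hsm₁, hmass, hneg, hbud⟩

/-- **(E2-F2) `PairLadderStepAtV17F2 … n` (`1 ≤ n`) from the class-#5 complementary FAMILY at scale `n−1`** (`PairTransferFamilyHard … (n−1)`, p544581): the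
member consumed is `m := n`, i.e. `D = D^{K_{n−1}}_{n−1} − D^{K_{n−1}}_n` (the single slice `g_n` smearing; KLTC-INDEX-v6 §B step 3), whose tower along slice `n` ends at the
PLAIN array.  Corollary of `pairLadderStepAtV17F2_of_pairTransferAtCov`; the caller's per-class tower data are the same with that `D`. -/
theorem pairLadderStepAtV17F2_of_pairTransferFamilyHard {G : GeoConsts} {P : SplitConsts} {Q : EngConsts} {r β U μ : ℝ} {n : ℕ} {m : ℝ}
    (hn : 1 ≤ n) (hG : 0 ≤ G.bhi) (hm : 0 ≤ m)
    (hC₀ : ∀ Qm s t, ‖klPairArrayF L M β U μ (n - 1) Qm s t‖ ≤ m)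
    (hfam : PairTransferFamilyHard L M G P r β U μ (n - 1))
    (hR'0 : ∀ Qm k k', 0 ≤ transferBarAt L G P r β U (n - 1) Qm k k')
    (hsm₀ : m * (G.bhi / 4) ≤ 1 / 3)
    (htower : ∀ Qm : TorusSite 2 L, IsPairClassAt L Qm n →
      ∃ (X N : Matrix (TorusSite 2 L) (TorusSite 2 L) ℂ) (w₁ : TorusSite 2 L → ℝ) (Ea E₁ : TorusSite 2 L → TorusSite 2 L → ℝ) (r' e₁ : ℝ),
        0 ≤ r' ∧ 0 ≤ e₁ ∧
        (∀ x y, ¬(x ∈ klBall L μ 0 ∧ y ∈ klBall L μ 0) → X x y = 0) ∧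
        (∀ k ∈ klBall L μ 0, ∀ k' ∈ klBall L μ 0,
          X k k' = klCovSmearedPairAmplitude L M β U μ (klFlowFrameU L M β U μ (n - 1)) (n - 1)
            (KLRegimeWick.klSoftCov L M β μ (klFlowFrameU L M β U μ (n - 1)) (n - 1) -
              KLRegimeWick.klSoftCov L M β μ (klFlowFrameU L M β U μ (n - 1)) n) Qm k k') ∧
        (∀ x y, 0 ≤ Ea x y) ∧
        (1 + diagonal (fun p => (w₁ p : ℂ)) * X) * N = 1 ∧
        (∀ k ∈ klBall L μ 0, ∀ k' ∈ klBall L μ 0, ‖klPairArrayF L M β U μ n Qm k k' - (X * N) k k'‖ ≤ Ea k k') ∧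
        (∀ x y, transferBarAt L G P r β U (n - 1) Qm x y ≤ r') ∧
        (∀ x y, Ea x y + (transferBarAt L G P r β U (n - 1) Qm x y +
            3 / 2 * (3 / 2 * m) * ∑ t, transferBarAt L G P r β U (n - 1) Qm x t * |w₁ t| +
            3 / 2 * (3 / 2 * m + r') * ∑ a, |w₁ a| * transferBarAt L G P r β U (n - 1) Qm a y +
            9 / 4 * (3 / 2 * m + r') * (3 / 2 * m) * ∑ a, ∑ t, |w₁ a| * transferBarAt L G P r β U (n - 1) Qm a t * |w₁ t|) ≤ E₁ x y) ∧
        (∀ x y, E₁ x y ≤ e₁) ∧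
        (3 / 2 * m + r') * ∑ a, |w₁ a| ≤ 1 / 3 ∧
        (∑ p, |w₁ p| ≤ 3 / 4 * G.bhi) ∧
        (∑ p, (|w₁ p| - w₁ p) ≤ klEdge G n (klTorusNorm L Qm)) ∧
        (∀ k ∈ klBall L μ 0, ∀ k' ∈ klBall L μ 0,
          E₁ k k' ≤
            drivePBar G P U (n - 1) + eremBar G P Q U β L (n - 1) + thermalBar G P U β n +
              legDressBarQ2 G P Q U n (legSliceCountT L β μ (klFlowFrameU L M β U μ n) n ![k', Qm - k', Qm - k, k]) +
              (P.Klam * U) ^ 2 * (G.phGain n (klTorusNorm L (k - k')) + G.phGain n (klTorusNorm L (k + k' - Qm))) +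
              frameShiftBar P Q U n)) :
    PairLadderStepAtV17F2 L M G P Q β U μ n :=
  pairLadderStepAtV17F2_of_pairTransferAtCov L M hn hG hm hC₀ (hfam n (Nat.sub_le n 1)) hR'0 hsm₀ htower

end Model

end Summit.HubbardSuperconductivity.HubbardSuperconductivity.Theorems.KLRegimeSplit

end
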